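import Mathlib
import HarnessLib
import Literature.MathematicalPhysics.QuantumLattice.FermiRG.BGM2003SectorCountingTarget
import Summits.HubbardSuperconductivity.HubbardSuperconductivity.Theorems.KLProgrammeH10TwoPointLimitKlAnisoAncestor
import Summits.HubbardSuperconductivity.HubbardSuperconductivity.Theorems.KLProgrammeAbsUmklappNarrowCount

/-!
# Route `KLProgramme` — K3 engine (stmt-HubbardSuperconductivity-20437), stub (b) (ℓ)/(I2)–(I3), located item «ABS-UMK-COUNT» / «UV-REMEASURE-COUNT»:
# the ANCHORED ABSOLUTE COUNT OF TARGET («umklapp») STRINGS — `(L−3)` law WITHOUT the near-fibre loss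

Cell gate-hubbard-kl, seat p4 g15 (memo HOME/prover-p4/UV-REMEASURE-COUNT.md §4–§5).  The strings of scale-`n′` sectors anchored at `ω₁` carrying momenta
with prescribed sum `R` (any vector, e.g. `2πG`) split into NARROW ones (free legs pairwise within pair angle `Φ₀`; counted by `card_narrowStrings_le`,
the chart/slicing/thin-level-set route of this lineage) and WIDE ones (some free pair at pair angle `> Φ₀`; counted by BGM 2003's Lemma 7.5 route
`BGM2003.count_target_wide`, run relative to the two scale-0 sectors and with the trivially true wedge `Ψ = π/2`):

* `sSector2003_subset_scaleZero` — every scale-`n′` s-sector lies in its scale-`0` ancestor (BGM 2003 §7.4 (i));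
* **`card_targetStrings_le`** — in the fine-scale regime (`2^{−n′}` small against `Φ₀/L`),
  `#{ω : ω_{i₁} = ω₁, ∃ k_i ∈ S_{n′,ω_i}, Σ k_i = R} ≤ 2L⁴·T_bound·N·K₀^{L−5} + L²·2^L·L²·B_fib·(3·2^{n′})^{L−3}` — both terms `C(L)·N^{L−3}`, `N = 2^{n′+1}`:
  the anchored ABSOLUTE `(L−3)` law for target strings with NO loss in `N` (compare `BGM2003.count_target`, whose near-fibre term costs a factor `N` at
  scale `0`).

Everything is PROVED; no definitions, no named facts. [cite: BenfattoGiulianiMastropietro2003, §3.1 Lemma 3.1 (4.3) p.17 and §7.4 p.28]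
-/

noncomputable section

open Real Set
open Literature.MathematicalPhysics.QuantumLattice Literature.MathematicalPhysics.QuantumLattice.FermiRG
open Literature.MathematicalPhysics.QuantumLattice.FermiRG.BGM2003
open Summit.HubbardSuperconductivity.HubbardSuperconductivity.Theorems.ThinLevelSet
open Summit.HubbardSuperconductivity.HubbardSuperconductivity.Theorems

namespace Summit.HubbardSuperconductivity.HubbardSuperconductivity.Theorems.AbsUmklappCount

set_option linter.dupNamespace false -- summit = problem name (single-conjunct summit), D-0017

/-! ## §1 Scale-`0` ancestors of s-sectors -/

/-- **Every fine s-sector lies in its scale-`0` ancestor**: `S_{n′,ω′} ⊆ S_{0, ω′/2^{n′}}` for BGM 2003's s-sectors of the polar chart.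
[cite: BenfattoGiulianiMastropietro2003, §7.4 p.27 (L158) – p.28 (L4)] -/
theorem sSector2003_subset_scaleZero {u : ℝ → ℝ → ℝ} {e₀ : ℝ} (he : 0 ≤ e₀) (n' ω' : ℕ) :
    BGM2003.sSector u e₀ n' (ω' : ℤ) ⊆ BGM2003.sSector u e₀ 0 ((ω' / 2 ^ n' : ℕ) : ℤ) := by
  rintro p ⟨θ, e, he', hw, hp⟩
  refine ⟨θ, e, ?_, ?_, hp⟩
  · refine he'.trans ?_
    have h1 : (4 : ℝ) ^ (-(n' : ℤ)) ≤ (4 : ℝ) ^ (-((0 : ℕ) : ℤ)) := zpow_le_zpow_right₀ (by norm_num) (by simp)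
    exact mul_le_mul_of_nonneg_right h1 he
  · have h := PerturbedFermiCurve.sectorWeightCirc_ne_zero_of_le (Nat.zero_le n') hw
    rwa [Nat.sub_zero] at h

/-! ## §2 The anchored absolute count of target strings -/

open Classical in
/-- **The anchored absolute `(L−3)` count of target strings** (narrow part by the chart/slicing route, wide part by `BGM2003.count_target_wide` relative to
scale `0`).  See the module docstring for the shape of the bound; the hypotheses are those of `card_narrowStrings_le` and of `count_target_wide` together
with the fine-scale regime conditions. [cite: BenfattoGiulianiMastropietro2003, §3.1 Lemma 3.1 (4.3) p.17 (L46–58) and §7.4 p.28 (L6–125)] -/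
theorem card_targetStrings_le {ε : (Fin 2 → ℝ) → ℝ} {μ e₀ : ℝ} {u : ℝ → ℝ → ℝ} (hD : DispersionHyp ε μ e₀ u) {c₂ c₃ K₁ K₂ c₀ c₂' η₀ : ℝ}
    (hlip : ∀ θ₁ θ₂ : ℝ, FermiRG.torusDist (normalAngle u θ₂ 0 - normalAngle u θ₁ 0) ≤ c₂ * FermiRG.torusDist (θ₂ - θ₁))
    (hpi : ∀ θ : ℝ, normalAngle u (θ + π) 0 = normalAngle u θ 0 + π) (hc₂ : 0 ≤ c₂) (hc₃ : 0 < c₃)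
    (h73 : ∀ (n ω : ℕ), ω < sectorCount n → ∀ p ∈ sSector u e₀ n ω,
      ∃ k₁ k₂ : ℝ,
        p = fermiPoint u (sectorCenter n ω) + k₁ • unitNormal u (sectorCenter n ω) 0 +
              k₂ • unitTangent u (sectorCenter n ω) 0 ∧
        |k₁| ≤ c₃ * (4 : ℝ) ^ (-(n : ℤ)) ∧ |k₂| ≤ c₃ * (2 : ℝ) ^ (-(n : ℤ)) ∧
        |fderiv ℝ ε p (unitTangent u (sectorCenter n ω) 0)| ≤ c₃ * (2 : ℝ) ^ (-(n : ℤ)))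
    (hK₁0 : 0 ≤ K₁)
    (hK₂ : K₂ = K₁ * π + 4) (hc₀ : 0 < c₀) (hc₂' : 0 < c₂') (hη₀ : 0 < η₀)
    (h75 : ∀ θ₁' θ₂' η r₁ r₂ : ℝ, (θ₁', θ₂') ∈ pairChartDomain →
        |r₁| ≤ (2 * K₁ + 4 * c₂) / K₂ * η * pairAngle θ₁' θ₂' → |r₂| ≤ η → η ≤ c₂' * pairAngle θ₁' θ₂' →
          η ≤ η₀ →
          fermiPoint u θ₁' + fermiPoint u θ₂' + (r₁ • unitNormal u θ₁' 0 + r₂ • unitTangent u θ₁' 0)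
              ∈ pairRange u ∧
          ∃ θ₁ θ₂ : ℝ,
            fermiPoint u θ₁' + fermiPoint u θ₂' + (r₁ • unitNormal u θ₁' 0 + r₂ • unitTangent u θ₁' 0) =
              fermiPoint u θ₁ + fermiPoint u θ₂ ∧
            |θ₁ - θ₁'| ≤ c₀ * η ∧ |θ₂ - θ₂'| ≤ c₀ * η)
    {s₁ Φ cf Af Bf M₁ : ℝ} (hs₁ : 0 < s₁) (hM₁ : 0 ≤ M₁) (hΦ : 0 < Φ) (hcf : 0 < cf) (hcfA : cf ≤ Af) (hBf : 0 ≤ Bf)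
    (hchart : ∀ θs : ℝ, ∃ f f' f'' : ℝ → ℝ, Measurable f ∧
        (∀ φ ∈ Icc (-Φ) Φ,
          f ((fermiPoint u (θs + φ) - fermiPoint u θs) ⬝ᵥ tdir θs) = -((fermiPoint u (θs + φ) - fermiPoint u θs) ⬝ᵥ dir θs)) ∧
        (∀ y ∈ Icc (-(s₁ / 4 * Φ)) (s₁ / 4 * Φ), HasDerivAt f (f' y) y ∧ HasDerivAt f' (f'' y) y ∧
          cf ≤ f'' y ∧ f'' y ≤ Af ∧ |f' y| ≤ Bf) ∧
        (∀ φ ∈ Icc (-Φ) Φ, ∀ φ' ∈ Icc (-Φ) Φ,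
          s₁ / 2 * |φ - φ'| ≤ |(fermiPoint u (θs + φ) - fermiPoint u θs) ⬝ᵥ tdir θs - (fermiPoint u (θs + φ') - fermiPoint u θs) ⬝ᵥ tdir θs| ∧
          |(fermiPoint u (θs + φ) - fermiPoint u θs) ⬝ᵥ tdir θs - (fermiPoint u (θs + φ') - fermiPoint u θs) ⬝ᵥ tdir θs| ≤ M₁ * |φ - φ'|) ∧
        (fermiPoint u (θs + 0) - fermiPoint u θs) ⬝ᵥ tdir θs = 0)
    {n' L : ℕ} (hL : 6 ≤ L) (i₁ : Fin L) {ω₁ : ℕ} (hω₁ : ω₁ < sectorCount n') (R : Fin 2 → ℝ)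
    {Φ₀ LΨ Bfib : ℝ} (hΦ₀ : 0 ≤ Φ₀) (h2Φ₀ : 2 * Φ₀ ≤ Φ) (hK₁c : 2 + c₂ ≤ K₁)
    (hLΨ : LΨ = L + c₂ * (π / 2) / (K₁ * Φ₀)) (hΦt : (2 : ℝ) ^ (-(n' : ℤ)) ≤ Φ₀) (hΦδ : c₃ * (2 : ℝ) ^ (-(n' : ℤ)) ≤ Φ₀)
    (hΦη : K₂ * LΨ * (c₃ * (2 : ℝ) ^ (-(n' : ℤ))) ≤ c₂' * Φ₀)
    (hBfib : max ((2 * ((2 * c₀ * K₂ * c₃ / π + 1) * LΨ)) ^ 2) (4 * c₃ ^ 2 * K₂ ^ 2 / η₀ ^ 2 * LΨ ^ 2) ≤ Bfib)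
    (hreg : 6 * (M₁ * (2 * Φ₀)) + 3 * (L * (4 * c₃ * (2 : ℝ) ^ (-(n' : ℤ)))) + 2 * (s₁ / 2 * sectorWidth n') ≤ s₁ / 4 * Φ) :
    (Nat.card {ω : Fin L → Fin (sectorCount n') |
        (ω i₁ : ℕ) = ω₁ ∧ ∃ k : Fin L → (Fin 2 → ℝ), (∀ i, k i ∈ sSector u e₀ n' (ω i : ℕ)) ∧ ∑ i, k i = R} : ℝ) ≤
      2 * (L : ℝ) ^ 4 *
        ((2 * (L * (4 * c₃ * (2 : ℝ) ^ (-(n' : ℤ)))) / (s₁ / 2 * sectorWidth n') + 1) *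
          (960 * Af * (2 * (L * (4 * c₃ * (2 : ℝ) ^ (-(n' : ℤ))) + Bf * (L * (4 * c₃ * (2 : ℝ) ^ (-(n' : ℤ))))) +
            (4 * Bf + 1) * (s₁ / 2 * sectorWidth n')) / cf ^ 2 / (s₁ / 2 * sectorWidth n') ^ 2) *
        ((sectorCount n' : ℝ) * (2 * (2 * Φ₀ / sectorWidth n' + 1)) ^ (L - 5))) +
      (L : ℝ) ^ 2 * 2 ^ L * (L ^ 2 * (Bfib * (3 * (2 : ℝ) ^ n') ^ (L - 3))) := by
  have he₀ : 0 ≤ e₀ := hD.e₀_pos.le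
  have hL4 : 4 ≤ L := by omega
  -- the strings as a Finset
  set Str : Set (Fin L → Fin (sectorCount n')) := {ω |
        (ω i₁ : ℕ) = ω₁ ∧ ∃ k : Fin L → (Fin 2 → ℝ), (∀ i, k i ∈ sSector u e₀ n' (ω i : ℕ)) ∧ ∑ i, k i = R} with hStr
  set S := Str.toFinset with hS
  have hmemS : ∀ ω, ω ∈ S ↔ (ω i₁ : ℕ) = ω₁ ∧ ∃ k : Fin L → (Fin 2 → ℝ), (∀ i, k i ∈ sSector u e₀ n' (ω i : ℕ)) ∧ ∑ i, k i = R := by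
    intro ω; rw [hS, Set.mem_toFinset, hStr, Set.mem_setOf_eq]
  have hcardS : Nat.card Str = S.card := by rw [hS, Nat.card_eq_card_toFinset]
  rw [hcardS]
  -- narrow / wide split
  set nar : (Fin L → Fin (sectorCount n')) → Prop := fun ω =>
    ∀ i j : Fin L, i ≠ i₁ → j ≠ i₁ → pairAngle (sectorCenter n' (ω i)) (sectorCenter n' (ω j)) ≤ Φ₀ with hnar
  set Snar := S.filter fun ω => nar ω with hSnar
  set Swide := S.filter fun ω => ¬ nar ω with hSwide
  have hsplit : S.card = Snar.card + Swide.card := by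
    rw [hSnar, hSwide, Finset.card_filter_add_card_filter_not]
  -- the narrow part
  set NarF := (Finset.univ : Finset (Fin L → Fin (sectorCount n'))).filter fun ω =>
        (ω i₁ : ℕ) = ω₁ ∧ (∀ i j : Fin L, i ≠ i₁ → j ≠ i₁ → pairAngle (sectorCenter n' (ω i)) (sectorCenter n' (ω j)) ≤ Φ₀) ∧
        ∃ k : Fin L → (Fin 2 → ℝ), (∀ i, k i ∈ sSector u e₀ n' (ω i : ℕ)) ∧ ∑ i, k i = R with hNarF
  have hnarrow_sub : Snar ⊆ NarF := by
    intro ω hω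
    rw [hSnar, Finset.mem_filter, hmemS] at hω
    rw [hNarF, Finset.mem_filter]
    exact ⟨Finset.mem_univ _, hω.1.1, hω.2, hω.1.2⟩
  have hnarrow := card_narrowStrings_le hD hc₃ h73 hs₁ hM₁ hΦ hcf hcfA hBf hchart hL i₁ ω₁ R hΦ₀ h2Φ₀ hreg
  have h1 : (Snar.card : ℝ) ≤ (NarF.card : ℝ) := by exact_mod_cast Finset.card_le_card hnarrow_sub
  -- the wide part: classes by the wide pair and the scale-0 ancestor string
  set Pairs := (Finset.univ : Finset (Fin L × Fin L)).filter fun p => p.1 ≠ i₁ ∧ p.2 ≠ i₁ with hPairs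
  set Wset : Fin L × Fin L → (Fin L → Fin (sectorCount 0)) → Set (Fin L → Fin (sectorCount n')) := fun p ωt =>
    {ω : Fin L → Fin (sectorCount n') |
        (ω i₁ : ℕ) = ω₁ ∧ (∀ i' : Fin L, i' ≠ i₁ → sSector u e₀ n' (ω i' : ℕ) ⊆ sSector u e₀ 0 (ωt i' : ℕ)) ∧
        (∀ m : Fin L, m ≠ i₁ → pairAngle (sectorCenter n' (ω i₁)) (sectorCenter n' (ω m)) ≤ π / 2) ∧
        Φ₀ < pairAngle (sectorCenter n' (ω p.1)) (sectorCenter n' (ω p.2)) ∧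
        ∃ k : Fin L → (Fin 2 → ℝ), (∀ i' : Fin L, k i' ∈ sSector u e₀ n' (ω i' : ℕ)) ∧ ∑ i', k i' = R} with hWset
  have hWcard : ∀ p ∈ Pairs, ∀ ωt : Fin L → Fin (sectorCount 0),
      (((Wset p ωt).toFinset).card : ℝ) ≤ L ^ 2 * (Bfib * (3 * (2 : ℝ) ^ n') ^ (L - 3)) := by
    intro p hp ωt
    rw [hPairs, Finset.mem_filter] at hp
    have h := count_target_wide hD hlip hpi hc₂ hc₃ h73 hK₁0 hK₂ hc₀ hc₂' hη₀ h75 (Nat.zero_le n') hL4 i₁ hω₁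
      (ωt := fun i => ((ωt i : ℕ))) (fun i => (ωt i).isLt) R (Φ := Φ₀) (Ψ := π / 2) (LΨ := LΨ) (Bfib := Bfib)
      (by positivity) hK₁c hLΨ hΦt hΦδ hΦη hBfib hp.2.1 hp.2.2
    rw [Nat.sub_zero] at h
    rw [← Nat.card_eq_card_toFinset]
    exact h
  -- every wide string is in one of the classes
  have hpair_le : ∀ θ₁ θ₂ : ℝ, pairAngle θ₁ θ₂ ≤ π / 2 := by
    intro θ₁ θ₂
    rw [pairAngle, min_le_iff]
    rcases le_or_gt (FermiRG.torusDist (θ₁ - θ₂)) (π / 2) with h | h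
    · exact Or.inl h
    · exact Or.inr (by linarith)
  have hanc : ∀ ω : Fin L → Fin (sectorCount n'), ∀ i, (ω i : ℕ) / 2 ^ n' < sectorCount 0 := by
    intro ω i
    have h2 : sectorCount n' = 2 ^ n' * 2 := by simp [sectorCount, pow_succ]
    have h3 : (ω i : ℕ) < 2 ^ n' * 2 := (ω i).isLt.trans_eq h2
    have h0 : sectorCount 0 = 2 := by simp [sectorCount]
    rw [h0, Nat.div_lt_iff_lt_mul (by positivity)]
    linarith
  have hwide_sub : Swide ⊆ (Pairs ×ˢ (Finset.univ : Finset (Fin L → Fin (sectorCount 0)))).biUnion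
      fun q => (Wset q.1 q.2).toFinset := by
    intro ω hω
    rw [hSwide, Finset.mem_filter, hmemS] at hω
    obtain ⟨⟨hω₁', k, hk, hsum⟩, hnot⟩ := hω
    have hex : ∃ i j : Fin L, i ≠ i₁ ∧ j ≠ i₁ ∧ Φ₀ < pairAngle (sectorCenter n' (ω i)) (sectorCenter n' (ω j)) := by
      by_contra hcon
      apply hnot
      intro i j hi hj
      by_contra hle
      exact hcon ⟨i, j, hi, hj, not_le.1 hle⟩
    obtain ⟨i₀, j₀, hi₀, hj₀, hwide⟩ := hex
    set ωt : Fin L → Fin (sectorCount 0) := fun i => ⟨(ω i : ℕ) / 2 ^ n', hanc ω i⟩ with hωt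
    rw [Finset.mem_biUnion]
    refine ⟨((i₀, j₀), ωt), ?_, ?_⟩
    · rw [Finset.mem_product, hPairs, Finset.mem_filter]
      exact ⟨⟨Finset.mem_univ _, hi₀, hj₀⟩, Finset.mem_univ _⟩
    · rw [Set.mem_toFinset, hWset, Set.mem_setOf_eq]
      refine ⟨hω₁', fun i' _ => ?_, fun m _ => hpair_le _ _, hwide, k, hk, hsum⟩
      exact sSector2003_subset_scaleZero he₀ n' (ω i')
  -- counting the classes
  have hPairs_card : (Pairs.card : ℝ) ≤ (L : ℝ) ^ 2 := by
    have h1 : Pairs.card ≤ (Finset.univ : Finset (Fin L × Fin L)).card := Finset.card_le_card (Finset.filter_subset _ _)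
    rw [Finset.card_univ, Fintype.card_prod, Fintype.card_fin] at h1
    have h2 : (Pairs.card : ℝ) ≤ ((L * L : ℕ) : ℝ) := by exact_mod_cast h1
    refine h2.trans_eq ?_; push_cast; ring
  have hCT_card : ((Finset.univ : Finset (Fin L → Fin (sectorCount 0))).card : ℝ) = 2 ^ L := by
    rw [Finset.card_univ, Fintype.card_fun, Fintype.card_fin, Fintype.card_fin]
    simp [sectorCount]
  have hBnd0 : 0 ≤ (L : ℝ) ^ 2 * (Bfib * (3 * (2 : ℝ) ^ n') ^ (L - 3)) := by
    have hB : 0 ≤ Bfib := le_trans (le_max_of_le_left (sq_nonneg _)) hBfib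
    positivity
  have h2 : (Swide.card : ℝ) ≤ (L : ℝ) ^ 2 * 2 ^ L * (L ^ 2 * (Bfib * (3 * (2 : ℝ) ^ n') ^ (L - 3))) := by
    calc (Swide.card : ℝ)
        ≤ (((Pairs ×ˢ (Finset.univ : Finset (Fin L → Fin (sectorCount 0)))).biUnion fun q => (Wset q.1 q.2).toFinset).card : ℝ) := by
          exact_mod_cast Finset.card_le_card hwide_sub
      _ ≤ ∑ q ∈ Pairs ×ˢ (Finset.univ : Finset (Fin L → Fin (sectorCount 0))), (((Wset q.1 q.2).toFinset).card : ℝ) := by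
          exact_mod_cast Finset.card_biUnion_le
      _ ≤ ∑ _q ∈ Pairs ×ˢ (Finset.univ : Finset (Fin L → Fin (sectorCount 0))), (L : ℝ) ^ 2 * (Bfib * (3 * (2 : ℝ) ^ n') ^ (L - 3)) := by
          refine Finset.sum_le_sum fun q hq => ?_
          rw [Finset.mem_product] at hq
          exact hWcard q.1 hq.1 q.2
      _ = (Pairs.card : ℝ) * 2 ^ L * (L ^ 2 * (Bfib * (3 * (2 : ℝ) ^ n') ^ (L - 3))) := by
          rw [Finset.sum_const, nsmul_eq_mul, Finset.card_product, Nat.cast_mul, hCT_card]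
      _ ≤ (L : ℝ) ^ 2 * 2 ^ L * (L ^ 2 * (Bfib * (3 * (2 : ℝ) ^ n') ^ (L - 3))) := by
          gcongr
  -- assemble
  have h0 : (S.card : ℝ) = (Snar.card : ℝ) + (Swide.card : ℝ) := by rw [hsplit]; push_cast; ring
  rw [h0]
  exact add_le_add (h1.trans hnarrow) h2

end Summit.HubbardSuperconductivity.HubbardSuperconductivity.Theorems.AbsUmklappCount

end
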